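import Literature.Geometry.Kaehler.ComplexTorusIntegralLefschetzDecompositionDegreeThree
import HarnessLib

/-!
# The cokernels in `H^{2g−1}(X, ℤ)` of `θ^{∧(g−1)} ∧ (−)` on `H¹(X, ℤ)` and of the co-Lefschetz map `θ^{∧(g−2)} ∧ (−)` on `H³(X, ℤ)`,
# as groups, for a polarised complex torus of type `(d₁, …, d_g)`; the divided power `θ^{[g−2]} : H³(X, ℤ) → H^{2g−1}(X, ℤ)` is onto
# on a principally polarised torus

Layer `Literature/Geometry/Kaehler`, namespace `Literature.Geometry.Kaehler.ComplexTorus`; lane `lit-hodgefound` (Track 2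
foundations library), seat p09, generation 38, row g38-#3. THEOREMS ONLY (0 definitions); no named fact, net debt 0. Sequel of
g37-#1 `ComplexTorusIntegralLefschetzDecompositionDegreeThree` (`g = j + 2`, symplectic enumeration of type `d₁ ∣ ⋯ ∣ d_g`,
`θ = ofRealForm η`, `Ψ = θ^{∧(g−2)} ∧ (−) : H³ → H^{2g−1}`), whose §3–§4 present the two images

* `Ψ(H³(X, ℤ)) = ⊕_x ℤ · (g−2)! (∏_{ν ∉ {a(x), t(a(x))}} d_ν) · dx_{(x̄)°}` and
* `Ψ(θ ∧ H¹(X, ℤ)) = θ^{∧(g−1)} ∧ H¹(X, ℤ) = ⊕_x ℤ · (g−1)! (∏_{ν ≠ a(x)} d_ν) · dx_{(x̄)°}`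

as DIAGONAL lattices in the `ℤ`-basis `(dx_{(x̄)°})_x` of `H^{2g−1}(X, ℤ)` (`x` over the `2g` letters, `a(x)` its index, `x̄` its partner,
`t(a)` the largest index `≠ a`), and computed their indices. This file reads off the quotient GROUPS (§0: in a free lattice with basis
`(b_k)`, `⊕ ℤ c_k b_k / ⊕ ℤ e_k c_k b_k ≃+ ⊕_k ℤ/e_k`):

* §1 **`H^{2g−1}(X, ℤ)/θ^{∧(g−2)} ∧ H³(X, ℤ) ≃+ ⊕_x ℤ/((g−2)! ∏_{ν ∉ {a(x),t(a(x))}} d_ν)`** and, for the divided power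
  `θ^{[g−2]} = θ^{∧(g−2)}/(g−2)!` (an integral operator, g35-#1 §6), **`(g−2)! · H^{2g−1}(X, ℤ)/θ^{∧(g−2)} ∧ H³(X, ℤ) ≃+
  ⊕_x ℤ/∏_{ν ∉ {a(x),t(a(x))}} d_ν`** — a group in which `d_g` does not occur; in particular **`θ^{[g−2]} : H³(X, ℤ) → H^{2g−1}(X, ℤ)`
  is ONTO on a principally polarised torus** (`θ^{∧(g−2)} ∧ H³(X, ℤ) = (g−2)! · H^{2g−1}(X, ℤ)`; p.p. threefold: `θ ∧ H³(X, ℤ) = H⁵(X, ℤ)`),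
  more precisely onto exactly for the types `(1, …, 1, d_g)` (`g ≥ 3`);
* §2 **`H^{2g−1}(X, ℤ)/θ^{∧(g−1)} ∧ H¹(X, ℤ) ≃+ ⊕_x ℤ/((g−1)! ∏_{ν ≠ a(x)} d_ν)`** and **`(g−1)! · H^{2g−1}(X, ℤ)/θ^{∧(g−1)} ∧ H¹(X, ℤ) ≃+
  ⊕_x ℤ/∏_{ν ≠ a(x)} d_ν`** (the group form of g35-#1's index `((g−1)!)^{2g} (d₁⋯d_g)^{2g−2}`; `θ^{∧(g−1)} ∧ H¹ = θ^{∧(g−2)} ∧ (θ ∧ H¹)`);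
* §3 basis-free forms (any presentation of a polarised torus of type `d`; principal polarisations).

## References

* [cite: Lange2023AbelianVarietiesComplex, §5.4.1 Thm. 5.4.1, Thm. 5.4.2 and (5.22) (PDF p. 275); §2.5.3 Lemma 2.5.14, Thm. 2.5.16,
  Cor. 2.5.17 (c) (PDF p. 135); §4.2 Poincaré's formula (PDF p. 204); §1.5.1 (types, PDF p. 51); §2.1.1 (principal); §1.1.3
  Exercise 1.1.6 (7)–(8); §6.2.4 proof of Prop. 6.2.20 (PDF p. 310)]
* [cite: VoisinHodgeI2002, §6.2.3 Thm. 6.25 (PDF p. 125); §7.1.2 (PDF p. 134 L31); §7.2.2 (PDF p. 142 L10)]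
* [cite: Warner1983, 2.6 (associativity of `∧`)]
-/

noncomputable section

open Module Function
open Literature.LinearAlgebra.Alternating

namespace Literature.Geometry.Kaehler.ComplexTorus

section CoLefschetzCokernel

variable {ι : Type*} [Fintype ι] [DecidableEq ι] {E : Type*} [NormedAddCommGroup E] [NormedSpace ℂ E]
  (Φ : (ι → ℝ) ≃L[ℝ] E) {j : ℕ} {e₀ : Fin (j + 2) ⊕ Fin (j + 2) ≃ ι} {η : E [⋀^Fin 2]→L[ℝ] ℝ} {d : Fin (j + 2) → ℕ}

/-! ## §0 Lattice lemmas: a lattice is generated by its basis; `n · W`; the quotient of two diagonal lattices -/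

section Lattices

variable {M : Type*} [AddCommGroup M] {κ : Type*} [Fintype κ] {W : AddSubgroup M}

omit [Fintype ι] [DecidableEq ι] Φ in
/-- A free lattice is generated, as a subgroup, by any `ℤ`-basis: `W = ⟨b_k⟩`. [cite: Lange2023AbelianVarietiesComplex, §1.1.3 Exercise 1.1.6 (8) (the lattices `Hᵏ(X, ℤ) = ∧ᵏ H¹(X, ℤ)` and their monomial bases)] -/
theorem closure_range_coe_basis_eq (b : Basis κ ℤ ↥(AddSubgroup.toIntSubmodule W)) :
    AddSubgroup.closure (Set.range fun k ↦ ((b k : ↥(AddSubgroup.toIntSubmodule W)) : M)) = W := by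
  refine le_antisymm ((AddSubgroup.closure_le _).2 ?_) fun x hx ↦ ?_
  · rintro _ ⟨k, rfl⟩
    exact SetLike.coe_mem _
  · have h0 := congrArg Subtype.val (b.sum_repr ⟨x, hx⟩)
    rw [Submodule.coe_sum] at h0
    have hx' : x = ∑ k, b.repr ⟨x, hx⟩ k • ((b k : ↥(AddSubgroup.toIntSubmodule W)) : M) :=
      h0.symm.trans (Finset.sum_congr rfl fun k _ ↦ Submodule.coe_smul_of_tower _ _)
    rw [hx']
    refine AddSubgroup.sum_mem _ fun k _ ↦ AddSubgroup.zsmul_mem _ ?_ _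
    exact AddSubgroup.subset_closure ⟨k, rfl⟩

omit [Fintype ι] [DecidableEq ι] Φ in
/-- `n · W = ⟨n b_k⟩` for a `ℤ`-basis `(b_k)` of the lattice `W`. [cite: Lange2023AbelianVarietiesComplex, §1.1.3 Exercise 1.1.6 (8)] -/
theorem map_nsmul_eq_closure_range_smul_coe_basis (b : Basis κ ℤ ↥(AddSubgroup.toIntSubmodule W)) (n : ℕ) :
    W.map (nsmulAddMonoidHom n) =
      AddSubgroup.closure (Set.range fun k ↦ (n : ℤ) • ((b k : ↥(AddSubgroup.toIntSubmodule W)) : M)) := by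
  apply le_antisymm
  · rintro _ ⟨x, hx, rfl⟩
    have h0 := congrArg Subtype.val (b.sum_repr ⟨x, hx⟩)
    rw [Submodule.coe_sum] at h0
    have hx' : x = ∑ k, b.repr ⟨x, hx⟩ k • ((b k : ↥(AddSubgroup.toIntSubmodule W)) : M) :=
      h0.symm.trans (Finset.sum_congr rfl fun k _ ↦ Submodule.coe_smul_of_tower _ _)
    rw [nsmulAddMonoidHom_apply, hx', Finset.smul_sum]
    refine AddSubgroup.sum_mem _ fun k _ ↦ ?_
    rw [← natCast_zsmul, smul_smul, mul_comm, ← smul_smul]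
    refine AddSubgroup.zsmul_mem _ ?_ _
    exact AddSubgroup.subset_closure ⟨k, rfl⟩
  · rw [AddSubgroup.closure_le]
    rintro _ ⟨k, rfl⟩
    exact ⟨((b k : ↥(AddSubgroup.toIntSubmodule W)) : M), SetLike.coe_mem _, (natCast_zsmul _ _).symm⟩

variable [DecidableEq κ] {L₁ L₂ : AddSubgroup M}

omit [Fintype ι] [DecidableEq ι] Φ in
/-- **The quotient of two diagonal lattices.** In a free lattice `W` with basis `(b_k)`, the subgroups `L₁ = ⊕_k ℤ c_k b_k` and
`L₂ = ⊕_k ℤ e_k c_k b_k` (`c_k ≠ 0`, `e_k ≥ 1`) satisfy **`L₁/L₂ ≃+ ⊕_k ℤ/e_k`**: `L₁` is free on `(c_k b_k)` (g37-#1 §0) and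
`ℓ = Σ r_k c_k b_k ∈ L₂ ⟺ e_k ∣ r_k` for all `k`; the isomorphism is `ℓ ↦ (r_k mod e_k)_k`. (Elementary divisors of a pair of
"diagonal" lattices, as for the monomial lattices `Hᵏ(X, ℤ)` of a complex torus under the Lefschetz maps.)
[cite: Lange2023AbelianVarietiesComplex, §1.1.3 Exercise 1.1.6 (8); §5.4.1 (5.22) (PDF p. 275)] -/
theorem nonempty_addEquiv_quotient_pi_zmod_of_smul_basis (b : Basis κ ℤ ↥(AddSubgroup.toIntSubmodule W)) (c : κ → ℤ)
    (e : κ → ℕ) (hc : ∀ k, c k ≠ 0) (he : ∀ k, 0 < e k)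
    (h₁ : L₁ = AddSubgroup.closure (Set.range fun k ↦ c k • ((b k : ↥(AddSubgroup.toIntSubmodule W)) : M)))
    (h₂ : L₂ = AddSubgroup.closure (Set.range fun k ↦ ((e k : ℤ) * c k) • ((b k : ↥(AddSubgroup.toIntSubmodule W)) : M))) :
    Nonempty (↥L₁ ⧸ L₂.addSubgroupOf L₁ ≃+ ((k : κ) → ZMod (e k))) := by
  haveI : ∀ k, NeZero (e k) := fun k ↦ ⟨(he k).ne'⟩
  haveI hN₁ : (L₂.addSubgroupOf L₁).Normal := AddSubgroup.normal_of_isAddCommutative _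
  have hle : L₁ ≤ W := by
    rw [h₁, AddSubgroup.closure_le]
    rintro _ ⟨k, rfl⟩
    exact W.zsmul_mem (SetLike.coe_mem _) _
  have hle₂ : AddSubgroup.closure (Set.range fun k ↦ ((e k : ℤ) * c k) • ((b k : ↥(AddSubgroup.toIntSubmodule W)) : M)) ≤ W := by
    rw [AddSubgroup.closure_le]
    rintro _ ⟨k, rfl⟩
    exact W.zsmul_mem (SetLike.coe_mem _) _
  -- the basis `v k = c k • b k` of `L₁` (as in g37-#1 §0)
  have h₁mem : ∀ k, c k • ((b k : ↥(AddSubgroup.toIntSubmodule W)) : M) ∈ L₁ := fun k ↦ by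
    rw [h₁]
    exact AddSubgroup.subset_closure ⟨k, rfl⟩
  let v : κ → ↥(AddSubgroup.toIntSubmodule L₁) := fun k ↦
    ⟨c k • ((b k : ↥(AddSubgroup.toIntSubmodule W)) : M), h₁mem k⟩
  have hv : ∀ k, ((v k : ↥(AddSubgroup.toIntSubmodule L₁)) : M) =
      c k • ((b k : ↥(AddSubgroup.toIntSubmodule W)) : M) := fun _ ↦ rfl
  have hli₂ : LinearIndependent ℤ fun k ↦ c k • b k := by
    refine linearIndependent_iff'.2 fun s a ha k hk ↦ ?_
    have ha' : ∑ i ∈ s, (a i * c i) • b i = 0 := by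
      simpa only [mul_smul] using ha
    exact (mul_eq_zero.1 (linearIndependent_iff'.1 b.linearIndependent s _ ha' k hk)).resolve_right (hc k)
  have hliM : LinearIndependent ℤ fun k ↦ c k • ((b k : ↥(AddSubgroup.toIntSubmodule W)) : M) := by
    have h' := hli₂.map' (AddSubgroup.toIntSubmodule W).subtype (Submodule.ker_subtype _)
    refine (linearIndependent_equiv' (Equiv.refl κ) ?_).1 h'
    funext k
    simp only [comp_apply, Equiv.coe_refl, id_eq, Submodule.subtype_apply, Submodule.coe_smul_of_tower]
  have hli₁ : LinearIndependent ℤ v :=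
    LinearIndependent.of_comp (AddSubgroup.toIntSubmodule L₁).subtype
      ((linearIndependent_equiv' (Equiv.refl κ) (funext fun k ↦ by rfl)).1 hliM)
  have hsp : ⊤ ≤ Submodule.span ℤ (Set.range v) := by
    rintro x -
    have hx : (x : M) ∈ AddSubgroup.closure
        (Set.range fun k ↦ c k • ((b k : ↥(AddSubgroup.toIntSubmodule W)) : M)) := h₁.le x.2
    have hrange : (Set.range fun k ↦ c k • ((b k : ↥(AddSubgroup.toIntSubmodule W)) : M)) =
        (AddSubgroup.toIntSubmodule L₁).subtype '' Set.range v := by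
      rw [← Set.range_comp]; rfl
    rw [hrange, ← Submodule.span_int_eq_addSubgroupClosure, ← Submodule.map_span] at hx
    obtain ⟨y, hy, hyx⟩ := hx
    rwa [show x = y from Subtype.ext hyx.symm]
  let b₁ : Basis κ ℤ ↥(AddSubgroup.toIntSubmodule L₁) := Basis.mk hli₁ hsp
  have hb₁ : ∀ k, b₁ k = v k := fun k ↦ Basis.mk_apply hli₁ hsp k
  -- coordinates: along `b` of `W` they are `c k` times those along `b₁` of `L₁`
  have hexp : ∀ ℓ : ↥(AddSubgroup.toIntSubmodule L₁),
      (ℓ : M) = ∑ k, (b₁.repr ℓ k * c k) • ((b k : ↥(AddSubgroup.toIntSubmodule W)) : M) := fun ℓ ↦ by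
    conv_lhs => rw [← b₁.sum_repr ℓ]
    rw [Submodule.coe_sum]
    refine Finset.sum_congr rfl fun k _ ↦ ?_
    rw [Submodule.coe_smul_of_tower, hb₁, hv, smul_smul]
  have hcoord : ∀ (ℓ : ↥(AddSubgroup.toIntSubmodule L₁)) (k : κ),
      b.repr ⟨(ℓ : M), hle ℓ.2⟩ k = b₁.repr ℓ k * c k := fun ℓ k ↦ by
    have hsum : (⟨(ℓ : M), hle ℓ.2⟩ : ↥(AddSubgroup.toIntSubmodule W)) = ∑ i, (b₁.repr ℓ i * c i) • b i := by
      apply Subtype.ext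
      rw [Submodule.coe_sum]
      refine (hexp ℓ).trans (Finset.sum_congr rfl fun i _ ↦ ?_)
      rw [Submodule.coe_smul_of_tower]
    rw [hsum, Basis.repr_sum_self]
  -- `Θ : L₁ → ⊕_k ℤ/e_k`, `ℓ ↦ (b₁-coordinates mod e)`
  let Θ : ↥L₁ →+ ((k : κ) → ZMod (e k)) := AddMonoidHom.mk'
    (fun ℓ k ↦ ((b₁.repr ⟨ℓ.1, ℓ.2⟩ k : ℤ) : ZMod (e k)))
    (fun x y ↦ funext fun k ↦ by
      change ((b₁.repr (⟨x.1, x.2⟩ + ⟨y.1, y.2⟩) k : ℤ) : ZMod (e k)) =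
        ((b₁.repr ⟨x.1, x.2⟩ k : ℤ) : ZMod (e k)) + ((b₁.repr ⟨y.1, y.2⟩ k : ℤ) : ZMod (e k))
      rw [map_add, Finsupp.add_apply, Int.cast_add])
  have hΘ : ∀ (ℓ : ↥L₁) (k : κ), Θ ℓ k = ((b₁.repr ⟨ℓ.1, ℓ.2⟩ k : ℤ) : ZMod (e k)) := fun _ _ ↦ rfl
  -- onto: `Σ n_k (c_k b_k) ↦ (n_k)`
  have hsurj : Function.Surjective Θ := fun n ↦ by
    refine ⟨⟨((∑ k, ((n k).val : ℤ) • b₁ k : ↥(AddSubgroup.toIntSubmodule L₁)) : M),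
      (∑ k, ((n k).val : ℤ) • b₁ k : ↥(AddSubgroup.toIntSubmodule L₁)).2⟩, funext fun k ↦ ?_⟩
    rw [hΘ]
    change (((b₁.repr (∑ i, ((n i).val : ℤ) • b₁ i)) k : ℤ) : ZMod (e k)) = n k
    rw [Basis.repr_sum_self, Int.cast_natCast, ZMod.natCast_zmod_val]
  -- kernel: `Σ r_k (c_k b_k) ∈ L₂ ⟺ e_k ∣ r_k`
  have hdvd_of_mem : ∀ (y : M) (hy : y ∈ AddSubgroup.closure
      (Set.range fun k ↦ ((e k : ℤ) * c k) • ((b k : ↥(AddSubgroup.toIntSubmodule W)) : M))) (hyW : y ∈ W) (k : κ),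
      ((e k : ℤ) * c k) ∣ b.repr ⟨y, hyW⟩ k := by
    intro y hy
    refine AddSubgroup.closure_induction (p := fun y _ ↦ ∀ (hyW : y ∈ W) (k : κ), ((e k : ℤ) * c k) ∣ b.repr ⟨y, hyW⟩ k)
      ?_ ?_ ?_ ?_ hy
    · rintro _ ⟨i, rfl⟩ hyW k
      have h0 : (⟨((e i : ℤ) * c i) • ((b i : ↥(AddSubgroup.toIntSubmodule W)) : M), hyW⟩ :
          ↥(AddSubgroup.toIntSubmodule W)) = ((e i : ℤ) * c i) • b i :=
        Subtype.ext (by rw [Submodule.coe_smul_of_tower])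
      rw [h0, map_smul, Basis.repr_self, Finsupp.smul_apply, Finsupp.single_apply, smul_eq_mul]
      by_cases hik : i = k
      · subst hik
        rw [if_pos rfl, mul_one]
      · rw [if_neg hik, mul_zero]
        exact dvd_zero _
    · intro hyW k
      rw [show (⟨0, hyW⟩ : ↥(AddSubgroup.toIntSubmodule W)) = 0 from rfl, map_zero, Finsupp.zero_apply]
      exact dvd_zero _
    · intro x y hx hy ihx ihy hxyW k
      have hxW : x ∈ W := hle₂ hx
      have hyW : y ∈ W := hle₂ hy
      rw [show (⟨x + y, hxyW⟩ : ↥(AddSubgroup.toIntSubmodule W)) = ⟨x, hxW⟩ + ⟨y, hyW⟩ from rfl, map_add,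
        Finsupp.add_apply]
      exact dvd_add (ihx hxW k) (ihy hyW k)
    · intro x hx ihx hxW k
      have hxW' : x ∈ W := hle₂ hx
      rw [show (⟨-x, hxW⟩ : ↥(AddSubgroup.toIntSubmodule W)) = -⟨x, hxW'⟩ from rfl, map_neg, Finsupp.neg_apply]
      exact (ihx hxW' k).neg_right
  have hker : ∀ ℓ : ↥L₁, Θ ℓ = 0 ↔ ℓ ∈ L₂.addSubgroupOf L₁ := fun ℓ ↦ by
    rw [AddSubgroup.mem_addSubgroupOf, funext_iff]
    simp only [hΘ, Pi.zero_apply, ZMod.intCast_zmod_eq_zero_iff_dvd]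
    constructor
    · intro hdvd
      have hℓ : (ℓ : M) = ∑ k, (b₁.repr ⟨ℓ.1, ℓ.2⟩ k / (e k : ℤ)) •
          (((e k : ℤ) * c k) • ((b k : ↥(AddSubgroup.toIntSubmodule W)) : M)) := by
        refine (hexp ⟨ℓ.1, ℓ.2⟩).trans (Finset.sum_congr rfl fun k _ ↦ ?_)
        rw [smul_smul]
        congr 1
        rw [← mul_assoc, Int.ediv_mul_cancel (hdvd k)]
      rw [hℓ, h₂]
      refine AddSubgroup.sum_mem _ fun k _ ↦ AddSubgroup.zsmul_mem _ ?_ _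
      exact AddSubgroup.subset_closure ⟨k, rfl⟩
    · intro hℓ₂ k
      have hℓ₂' : (ℓ : M) ∈ AddSubgroup.closure
          (Set.range fun k ↦ ((e k : ℤ) * c k) • ((b k : ↥(AddSubgroup.toIntSubmodule W)) : M)) := h₂ ▸ hℓ₂
      have h3 := hdvd_of_mem (ℓ : M) hℓ₂' (hle ℓ.2) k
      rw [hcoord (⟨ℓ.1, ℓ.2⟩ : ↥(AddSubgroup.toIntSubmodule L₁)) k] at h3
      exact (mul_dvd_mul_iff_right (hc k)).1 h3
  have hkerEq : Θ.ker = L₂.addSubgroupOf L₁ := AddSubgroup.ext fun ℓ ↦ by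
    rw [AddMonoidHom.mem_ker]
    exact hker ℓ
  haveI hN₂ : Θ.ker.Normal := AddSubgroup.normal_of_isAddCommutative _
  exact ⟨(QuotientAddGroup.quotientAddEquivOfEq hkerEq).symm.trans (QuotientAddGroup.quotientKerEquivOfSurjective Θ hsurj)⟩

omit [Fintype ι] [DecidableEq ι] Φ in
/-- **The cokernel of a diagonal lattice**: `W/⊕_k ℤ e_k b_k ≃+ ⊕_k ℤ/e_k` for a `ℤ`-basis `(b_k)` of `W` and `e_k ≥ 1`.
[cite: Lange2023AbelianVarietiesComplex, §1.1.3 Exercise 1.1.6 (8); §5.4.1 (5.22) (PDF p. 275)] -/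
theorem nonempty_addEquiv_quotient_pi_zmod_of_basis (b : Basis κ ℤ ↥(AddSubgroup.toIntSubmodule W)) (e : κ → ℕ)
    (he : ∀ k, 0 < e k)
    (h₂ : L₂ = AddSubgroup.closure (Set.range fun k ↦ (e k : ℤ) • ((b k : ↥(AddSubgroup.toIntSubmodule W)) : M))) :
    Nonempty (↥W ⧸ L₂.addSubgroupOf W ≃+ ((k : κ) → ZMod (e k))) := by
  refine nonempty_addEquiv_quotient_pi_zmod_of_smul_basis b (fun _ ↦ 1) e (fun _ ↦ one_ne_zero) he ?_ (h₂.trans ?_)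
  · refine ((closure_range_coe_basis_eq b).symm).trans (congrArg AddSubgroup.closure (congrArg Set.range (funext fun k ↦ ?_)))
    rw [one_smul]
  · exact congrArg AddSubgroup.closure (congrArg Set.range (funext fun k ↦ by rw [mul_one]))

omit [Fintype ι] [DecidableEq ι] Φ in
/-- **The cokernel of a diagonal lattice inside `n · W`**: `n W/⊕_k ℤ n e_k b_k ≃+ ⊕_k ℤ/e_k` (`n ≥ 1`).
[cite: Lange2023AbelianVarietiesComplex, §1.1.3 Exercise 1.1.6 (8); §5.4.1 (5.22) (PDF p. 275)] -/
theorem nonempty_addEquiv_map_nsmul_quotient_pi_zmod_of_basis (b : Basis κ ℤ ↥(AddSubgroup.toIntSubmodule W)) {n : ℕ}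
    (hn : 0 < n) (e : κ → ℕ) (he : ∀ k, 0 < e k)
    (h₂ : L₂ = AddSubgroup.closure (Set.range fun k ↦ ((n * e k : ℕ) : ℤ) • ((b k : ↥(AddSubgroup.toIntSubmodule W)) : M))) :
    Nonempty (↥(W.map (nsmulAddMonoidHom n)) ⧸ L₂.addSubgroupOf (W.map (nsmulAddMonoidHom n)) ≃+ ((k : κ) → ZMod (e k))) := by
  refine nonempty_addEquiv_quotient_pi_zmod_of_smul_basis b (fun _ ↦ (n : ℤ)) e
    (fun _ ↦ by exact_mod_cast hn.ne') he (map_nsmul_eq_closure_range_smul_coe_basis b n) (h₂.trans ?_)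
  exact congrArg AddSubgroup.closure (congrArg Set.range (funext fun k ↦ by rw [Nat.cast_mul, mul_comm]))

end Lattices

/-! ## §1 The cokernel of the co-Lefschetz map `Ψ = θ^{∧(g−2)} ∧ (−) : H³(X, ℤ) → H^{2g−1}(X, ℤ)` -/

/-- **`H^{2g−1}(X, ℤ)/θ^{∧(g−2)} ∧ H³(X, ℤ) ≃+ ⊕_x ℤ/((g−2)! ∏_{ν ∉ {a(x), t(a(x))}} d_ν)`** for a Riemann form with a symplectic
enumeration of type `(d₁, …, d_g)` (`g = j + 2`; `t(a)` the largest index `≠ a`): the image `Ψ(H³(X, ℤ))` is the diagonal lattice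
`⊕_x ℤ (g−2)! (∏_{ν ∉ {a(x),t(a(x))}} d_ν) dx_{(x̄)°}` of g37-#1 §3 in the basis `(dx_{(x̄)°})_x` of `H^{2g−1}(X, ℤ)`. (g37-#1 gave the
ORDER of this cokernel; over `ℚ` the map is onto — hard Lefschetz.)
[cite: Lange2023AbelianVarietiesComplex, §5.4.1 Thm. 5.4.1 and (5.22) (PDF p. 275); §2.5.3 Thm. 2.5.16 (PDF p. 135); §1.1.3 Exercise 1.1.6 (8)] [cite: VoisinHodgeI2002, §6.2.3 Thm. 6.25 (PDF p. 125); §7.1.2 (PDF p. 134 L31)] -/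
theorem IsSymplecticEnum.nonempty_addEquiv_quotient_map_wedgePow_wedge_integralForms_three (h : IsSymplecticEnum Φ e₀ η d)
    (hη : IsRiemannForm Φ η) :
    Nonempty (↥(integralForms Φ (2 * j + 3)) ⧸ ((integralForms Φ 3).map (AddMonoidHom.mk'
        (fun x : E [⋀^Fin 3]→L[ℝ] ℂ ↦ (wedgePow (ofRealForm η) j).wedge x)
        (ContinuousAlternatingMap.wedge_add_right _))).addSubgroupOf (integralForms Φ (2 * j + 3)) ≃+
      ((x : Fin (j + 2) ⊕ Fin (j + 2)) → ZMod (j.factorial * ∏ ν ∈ ({Sum.elim id id x,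
          if Sum.elim id id x = Fin.last (j + 1) then ((Fin.last j).castSucc : Fin (j + 2)) else Fin.last (j + 1)} :
            Finset (Fin (j + 2)))ᶜ, d ν))) := by
  classical
  have hn : 1 + (2 * j + 3) = 2 * (j + 2) := by ring
  have hkl : (2 * j + 3) + 1 = Fintype.card ι := lk_eq_card (ilvEnum e₀) hn
  letI : LinearOrder ι := linearOrderOfOrientation (ilvEnum e₀)
  obtain ⟨b, hb⟩ := exists_basis_integralForms_coe_eq_latMonomial_complWord Φ e₀ hkl
  refine nonempty_addEquiv_quotient_pi_zmod_of_basis b _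
    (fun x ↦ Nat.mul_pos (Nat.factorial_pos j) (Finset.prod_pos fun ν _ ↦ h.pos hη ν))
    ((h.map_wedgePow_wedge_integralForms_three_eq_closure Φ hkl).trans
      (congrArg AddSubgroup.closure (congrArg Set.range (funext fun x ↦ by rw [hb]))))

/-- **The cokernel of the divided power `θ^{[g−2]} : H³(X, ℤ) → H^{2g−1}(X, ℤ)`**:
`(g−2)! · H^{2g−1}(X, ℤ)/θ^{∧(g−2)} ∧ H³(X, ℤ) ≃+ ⊕_x ℤ/∏_{ν ∉ {a(x), t(a(x))}} d_ν` (`g = j + 2`; `θ^{∧(g−2)} ∧ Hᵏ(X, ℤ) ⊆ (g−2)! ·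
H^{2g−2+k}(X, ℤ)`, g35-#1 §6) — a group in which `d_g` does not occur (`t(a) = g` for `a ≠ g`).
[cite: Lange2023AbelianVarietiesComplex, §5.4.1 Thm. 5.4.1 and (5.22) (PDF p. 275); §2.5.3 Thm. 2.5.16, Cor. 2.5.17 (PDF p. 135); §4.2 (PDF p. 204)] [cite: VoisinHodgeI2002, §7.1.2 (PDF p. 134 L31)] -/
theorem IsSymplecticEnum.nonempty_addEquiv_map_nsmul_quotient_map_wedgePow_wedge_integralForms_three
    (h : IsSymplecticEnum Φ e₀ η d) (hη : IsRiemannForm Φ η) :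
    Nonempty (↥((integralForms Φ (2 * j + 3)).map (nsmulAddMonoidHom j.factorial)) ⧸
        ((integralForms Φ 3).map (AddMonoidHom.mk'
          (fun x : E [⋀^Fin 3]→L[ℝ] ℂ ↦ (wedgePow (ofRealForm η) j).wedge x)
          (ContinuousAlternatingMap.wedge_add_right _))).addSubgroupOf
            ((integralForms Φ (2 * j + 3)).map (nsmulAddMonoidHom j.factorial)) ≃+
      ((x : Fin (j + 2) ⊕ Fin (j + 2)) → ZMod (∏ ν ∈ ({Sum.elim id id x,
          if Sum.elim id id x = Fin.last (j + 1) then ((Fin.last j).castSucc : Fin (j + 2)) else Fin.last (j + 1)} :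
            Finset (Fin (j + 2)))ᶜ, d ν))) := by
  classical
  have hn : 1 + (2 * j + 3) = 2 * (j + 2) := by ring
  have hkl : (2 * j + 3) + 1 = Fintype.card ι := lk_eq_card (ilvEnum e₀) hn
  letI : LinearOrder ι := linearOrderOfOrientation (ilvEnum e₀)
  obtain ⟨b, hb⟩ := exists_basis_integralForms_coe_eq_latMonomial_complWord Φ e₀ hkl
  exact nonempty_addEquiv_map_nsmul_quotient_pi_zmod_of_basis b (Nat.factorial_pos j) _
    (fun x ↦ Finset.prod_pos fun ν _ ↦ h.pos hη ν)
    ((h.map_wedgePow_wedge_integralForms_three_eq_closure Φ hkl).trans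
      (congrArg AddSubgroup.closure (congrArg Set.range (funext fun x ↦ by rw [hb]))))

omit [DecidableEq ι] in
/-- `[H^{2j+3}(X, ℤ) : j! · H^{2j+3}(X, ℤ)] = (j!)^{2g}` (`rk H^{2g−1}(X, ℤ) = C(2g, 2g−1) = 2g`, `g = j + 2`).
[cite: Lange2023AbelianVarietiesComplex, §1.1.3 Exercise 1.1.6 (8)] -/
theorem relIndex_map_nsmul_factorial_integralForms_of_card_eq (e : Fin (2 * (j + 2)) ≃ ι) :
    ((integralForms Φ (2 * j + 3)).map (nsmulAddMonoidHom j.factorial)).relIndex (integralForms Φ (2 * j + 3)) =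
      j.factorial ^ (2 * (j + 2)) := by
  haveI := free_integralForms Φ (2 * j + 3)
  haveI := finite_integralForms Φ (2 * j + 3)
  rw [AddSubgroup.relIndex_map_nsmul]
  congr 1
  refine (finrank_integralForms_eq_choose Φ (2 * j + 3)).trans ?_
  rw [← Fintype.card_congr e, Fintype.card_fin, show 2 * (j + 2) = (2 * j + 3) + 1 by ring, Nat.choose_succ_self_right]

/-- For a type `(1, …, 1, d_g)` every coefficient `∏_{ν ∉ {a, t(a)}} d_ν` is `1`: the excluded pair `{a, t(a)}` always contains
the top index `g`. [folklore] -/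
private theorem prod_compl_pair_eq_one₃₈ (d : Fin (j + 2) → ℕ) (h1 : ∀ i : Fin (j + 1), d i.castSucc = 1) (a : Fin (j + 2)) :
    ∏ ν ∈ ({a, if a = Fin.last (j + 1) then ((Fin.last j).castSucc : Fin (j + 2)) else Fin.last (j + 1)} :
      Finset (Fin (j + 2)))ᶜ, d ν = 1 := by
  refine Finset.prod_eq_one fun ν hν ↦ ?_
  rw [Finset.mem_compl, Finset.mem_insert, Finset.mem_singleton, not_or] at hν
  have hν' : ν ≠ Fin.last (j + 1) := by
    rintro rfl
    by_cases ha : a = Fin.last (j + 1)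
    · exact hν.1 ha.symm
    · rw [if_neg ha] at hν
      exact hν.2 rfl
  obtain ⟨i, rfl⟩ := Fin.exists_castSucc_eq.2 hν'
  exact h1 i

/-- **`θ^{[g−2]} : H³(X, ℤ) → H^{2g−1}(X, ℤ)` is ONTO for every type `(1, …, 1, d_g)`**: for a symplectic enumeration with
`d₁ = ⋯ = d_{g−1} = 1` (`g = j + 2`, `d_g` arbitrary), **`θ^{∧(g−2)} ∧ H³(X, ℤ) = (g−2)! · H^{2g−1}(X, ℤ)`** — both sides have index
`((g−2)!)^{2g}` in `H^{2g−1}(X, ℤ)` (g37-#1: `[H^{2g−1} : θ^{g−2} ∧ H³] = ∏_x (g−2)! ∏_{ν ∉ {a(x),t(a(x))}} d_ν`, and `d_g` never occurs)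
and one contains the other (g35-#1 §6).
[cite: Lange2023AbelianVarietiesComplex, §5.4.1 Thm. 5.4.1 and (5.22) (PDF p. 275); §2.5.3 Thm. 2.5.16, Cor. 2.5.17 (PDF p. 135); §1.5.1 (PDF p. 51)] [cite: VoisinHodgeI2002, §7.1.2 (PDF p. 134 L31)] -/
theorem IsSymplecticEnum.map_wedgePow_wedge_integralForms_three_eq_map_nsmul_of_castSucc_eq_one
    (h : IsSymplecticEnum Φ e₀ η d) (hη : IsRiemannForm Φ η) (h1 : ∀ i : Fin (j + 1), d i.castSucc = 1) :
    (integralForms Φ 3).map (AddMonoidHom.mk'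
        (fun x : E [⋀^Fin 3]→L[ℝ] ℂ ↦ (wedgePow (ofRealForm η) j).wedge x)
        (ContinuousAlternatingMap.wedge_add_right _)) =
      (integralForms Φ (2 * j + 3)).map (nsmulAddMonoidHom j.factorial) := by
  classical
  have hSN := h.map_wedgePow_wedge_integralForms_le_map_nsmul Φ j 3
  have hNH : (integralForms Φ (2 * j + 3)).map (nsmulAddMonoidHom j.factorial) ≤ integralForms Φ (2 * j + 3) := by
    rintro _ ⟨x, hx, rfl⟩
    exact AddSubgroup.nsmul_mem _ hx _
  refine le_antisymm hSN (AddSubgroup.relIndex_eq_one.1 ?_)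
  have hmul := AddSubgroup.relIndex_mul_relIndex _ _ _ hSN hNH
  rw [h.relIndex_map_wedgePow_wedge_integralForms_three Φ hη, relIndex_map_nsmul_factorial_integralForms_of_card_eq Φ (ilvEnum e₀)]
    at hmul
  simp only [prod_compl_pair_eq_one₃₈ d h1, mul_one, Finset.prod_const, Finset.card_univ, Fintype.card_sum, Fintype.card_fin]
    at hmul
  rw [← two_mul] at hmul
  exact Nat.eq_of_mul_eq_mul_right (pow_pos (Nat.factorial_pos j) _) (hmul.trans (one_mul _).symm)

/-- **Conversely (`g ≥ 3`): if `θ^{∧(g−2)} ∧ H³(X, ℤ) = (g−2)! · H^{2g−1}(X, ℤ)` then `d₁ = ⋯ = d_{g−1} = 1`** (`g = j + 2`, `j ≥ 1`):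
the cokernel `⊕_x ℤ/∏_{ν ∉ {a(x),t(a(x))}} d_ν` sees `d_ν` for `ν ≤ g − 2` at the letters of index `g` and `d_{g−1}` at the letters of
index `1 ≤ g − 2`. So **`θ^{[g−2]} : H³(X, ℤ) → H^{2g−1}(X, ℤ)` is onto exactly for the types `(1, …, 1, d_g)`** (for `g = 2` it is the
identity of `H³`). [cite: Lange2023AbelianVarietiesComplex, §5.4.1 Thm. 5.4.1 and (5.22) (PDF p. 275); §1.5.1 (PDF p. 51)] -/
theorem IsSymplecticEnum.apply_castSucc_eq_one_of_map_wedgePow_wedge_integralForms_three_eq_map_nsmul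
    (h : IsSymplecticEnum Φ e₀ η d) (hη : IsRiemannForm Φ η) (hj : 0 < j)
    (hSN : (integralForms Φ 3).map (AddMonoidHom.mk'
        (fun x : E [⋀^Fin 3]→L[ℝ] ℂ ↦ (wedgePow (ofRealForm η) j).wedge x)
        (ContinuousAlternatingMap.wedge_add_right _)) =
      (integralForms Φ (2 * j + 3)).map (nsmulAddMonoidHom j.factorial)) (i : Fin (j + 1)) :
    d i.castSucc = 1 := by
  classical
  have hNH : (integralForms Φ (2 * j + 3)).map (nsmulAddMonoidHom j.factorial) ≤ integralForms Φ (2 * j + 3) := by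
    rintro _ ⟨x, hx, rfl⟩
    exact AddSubgroup.nsmul_mem _ hx _
  have hmul := AddSubgroup.relIndex_mul_relIndex _ _ _ hSN.le hNH
  rw [h.relIndex_map_wedgePow_wedge_integralForms_three Φ hη, relIndex_map_nsmul_factorial_integralForms_of_card_eq Φ (ilvEnum e₀),
    hSN, AddSubgroup.relIndex_self, one_mul, Finset.prod_mul_distrib, Finset.prod_const, Finset.card_univ, Fintype.card_sum,
    Fintype.card_fin, ← two_mul] at hmul
  have hP : ∏ x : Fin (j + 2) ⊕ Fin (j + 2), ∏ ν ∈ ({Sum.elim id id x,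
      if Sum.elim id id x = Fin.last (j + 1) then ((Fin.last j).castSucc : Fin (j + 2)) else Fin.last (j + 1)} :
        Finset (Fin (j + 2)))ᶜ, d ν = 1 :=
    Nat.eq_of_mul_eq_mul_left (pow_pos (Nat.factorial_pos j) _) (hmul.symm.trans (mul_one _).symm)
  -- a letter `x` whose coefficient involves `d_i`: index `g` if `i ≤ g − 2`, index `1` if `i = g − 1`
  have key : ∃ x : Fin (j + 2) ⊕ Fin (j + 2), i.castSucc ∈ ({Sum.elim id id x,
      if Sum.elim id id x = Fin.last (j + 1) then ((Fin.last j).castSucc : Fin (j + 2)) else Fin.last (j + 1)} :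
        Finset (Fin (j + 2)))ᶜ := by
    by_cases hi : i = Fin.last j
    · refine ⟨Sum.inl 0, ?_⟩
      rw [Finset.mem_compl, Finset.mem_insert, Finset.mem_singleton, not_or, Sum.elim_inl, id_eq,
        if_neg (Fin.last_pos : (0 : Fin (j + 2)) < Fin.last (j + 1)).ne]
      subst hi
      refine ⟨fun h0 ↦ ?_, (Fin.castSucc_lt_last _).ne⟩
      rw [Fin.ext_iff, Fin.val_castSucc, Fin.val_last, Fin.val_zero] at h0
      omega
    · refine ⟨Sum.inl (Fin.last (j + 1)), ?_⟩
      rw [Finset.mem_compl, Finset.mem_insert, Finset.mem_singleton, not_or, Sum.elim_inl, id_eq, if_pos rfl]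
      exact ⟨(Fin.castSucc_lt_last _).ne, fun h' ↦ hi (Fin.castSucc_injective _ h')⟩
  obtain ⟨x, hx⟩ := key
  have hdvd : d i.castSucc ∣ ∏ x : Fin (j + 2) ⊕ Fin (j + 2), ∏ ν ∈ ({Sum.elim id id x,
      if Sum.elim id id x = Fin.last (j + 1) then ((Fin.last j).castSucc : Fin (j + 2)) else Fin.last (j + 1)} :
        Finset (Fin (j + 2)))ᶜ, d ν :=
    (Finset.dvd_prod_of_mem _ hx).trans (Finset.dvd_prod_of_mem _ (Finset.mem_univ x))
  rw [hP] at hdvd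
  exact Nat.dvd_one.1 hdvd

/-- **`θ^{[g−2]} : H³(X, ℤ) → H^{2g−1}(X, ℤ)` is ONTO on a principally polarised torus**: for a symplectic enumeration of type
`(1, …, 1)` (`g = j + 2`), **`θ^{∧(g−2)} ∧ H³(X, ℤ) = (g−2)! · H^{2g−1}(X, ℤ)`** — both have index `((g−2)!)^{2g}` in `H^{2g−1}(X, ℤ)`
(g37-#1: `[H^{2g−1} : θ^{g−2} ∧ H³] = ∏_x (g−2)! ∏_{ν ∉ {a,t(a)}} d_ν`) and one contains the other. P.p. threefold: `θ ∧ H³(X, ℤ) = H⁵(X, ℤ)`;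
p.p. fourfold: `θ^{∧2} ∧ H³(X, ℤ) = 2 · H⁷(X, ℤ)`. (Contrast: on `H²` the divided power `θ^{[g−2]}` has cokernel `ℤ/(g−1)`, g35-#4, and
on `H³ → H^{2g−3}` cokernel `(ℤ/(g−2))^{2g}`, g38-#1.)
[cite: Lange2023AbelianVarietiesComplex, §2.1.1 (principal = type `(1, …, 1)`); §5.4.1 Thm. 5.4.1 and (5.22) (PDF p. 275); §2.5.3 Thm. 2.5.16, Cor. 2.5.17 (PDF p. 135); §4.2 Poincaré's formula (PDF p. 204)] [cite: VoisinHodgeI2002, §7.1.2 (PDF p. 134 L31)] -/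
theorem IsSymplecticEnum.map_wedgePow_wedge_integralForms_three_eq_map_nsmul_of_type_one (h : IsSymplecticEnum Φ e₀ η d)
    (hη : IsRiemannForm Φ η) (h1 : ∀ i, d i = 1) :
    (integralForms Φ 3).map (AddMonoidHom.mk'
        (fun x : E [⋀^Fin 3]→L[ℝ] ℂ ↦ (wedgePow (ofRealForm η) j).wedge x)
        (ContinuousAlternatingMap.wedge_add_right _)) =
      (integralForms Φ (2 * j + 3)).map (nsmulAddMonoidHom j.factorial) :=
  h.map_wedgePow_wedge_integralForms_three_eq_map_nsmul_of_castSucc_eq_one Φ hη fun i ↦ h1 i.castSucc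

/-! ## §2 The cokernel of `θ^{∧(g−1)} ∧ (−) : H¹(X, ℤ) → H^{2g−1}(X, ℤ)` as a group -/

omit [Fintype ι] [DecidableEq ι] in
/-- `θ^{∧j} ∧ (θ ∧ H¹(X, ℤ)) = θ^{∧(j+1)} ∧ H¹(X, ℤ)` as subgroups of `H^{2j+3}(X, ℂ)` — re-bracketing `θ^{∧j} ∧ (θ ∧ φ) = (θ^{∧j} ∧ θ) ∧ φ =
θ^{∧(j+1)} ∧ φ` (associativity of `∧`, up to the reindexing `2j + (2 + 1) = 2(j+1) + 1`). [cite: Warner1983, 2.6] -/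
theorem map_wedgePow_wedge_map_wedge_integralForms_one_eq_map_wedgePow_succ_wedge :
    ((integralForms Φ 1).map (AddMonoidHom.mk'
        (fun x : E [⋀^Fin 1]→L[ℝ] ℂ ↦ ((ofRealForm η).wedge x : E [⋀^Fin 3]→L[ℝ] ℂ))
        (ContinuousAlternatingMap.wedge_add_right _))).map (AddMonoidHom.mk'
        (fun x : E [⋀^Fin 3]→L[ℝ] ℂ ↦ (wedgePow (ofRealForm η) j).wedge x)
        (ContinuousAlternatingMap.wedge_add_right _)) =
      (integralForms Φ 1).map (AddMonoidHom.mk'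
        (fun x : E [⋀^Fin 1]→L[ℝ] ℂ ↦ ((wedgePow (ofRealForm η) (j + 1)).wedge x : E [⋀^Fin (2 * j + 3)]→L[ℝ] ℂ))
        (ContinuousAlternatingMap.wedge_add_right _)) := by
  rw [AddSubgroup.map_map]
  congr 1
  refine AddMonoidHom.ext fun φ ↦ ?_
  change (wedgePow (ofRealForm η) j).wedge ((ofRealForm η).wedge φ) = (wedgePow (ofRealForm η) (j + 1)).wedge φ
  have e1 : (wedgePow (ofRealForm η) j).wedge ((ofRealForm η).wedge φ) =
      (((wedgePow (ofRealForm η) j).wedge (ofRealForm η)).wedge φ).domDomCongr (finCongr (Nat.add_assoc (2 * j) 2 1)) := by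
    rw [ContinuousAlternatingMap.WedgeAssoc_holds ℝ E ℂ, domDomCongr_finCongr_trans, domDomCongr_finCongr_self]
  rw [e1]
  rfl

/-- **`H^{2g−1}(X, ℤ)/θ^{∧(g−1)} ∧ H¹(X, ℤ) ≃+ ⊕_x ℤ/((g−1)! ∏_{ν ≠ a(x)} d_ν)`** for a Riemann form with a symplectic enumeration of type
`(d₁, …, d_g)` (`g = j + 2`, the image written as `θ^{∧j} ∧ (θ ∧ H¹(X, ℤ))`): `θ^{∧(g−1)} ∧ H¹(X, ℤ)` is the diagonal lattice
`⊕_x ℤ (g−1)! (∏_{ν ≠ a(x)} d_ν) dx_{(x̄)°}` of g37-#1 §4 — the group form of g35-#1's index `((g−1)!)^{2g} (d₁⋯d_g)^{2g−2}`.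
[cite: Lange2023AbelianVarietiesComplex, §2.5.3 Cor. 2.5.17 (c) (PDF p. 135); §5.4.1 Thm. 5.4.1 and (5.22) (PDF p. 275); §1.1.3 Exercise 1.1.6 (8)] [cite: VoisinHodgeI2002, §7.2.2 (PDF p. 142 L10)] -/
theorem IsSymplecticEnum.nonempty_addEquiv_quotient_map_wedgePow_wedge_map_wedge_integralForms_one
    (h : IsSymplecticEnum Φ e₀ η d) (hη : IsRiemannForm Φ η) :
    Nonempty (↥(integralForms Φ (2 * j + 3)) ⧸ (((integralForms Φ 1).map (AddMonoidHom.mk'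
        (fun x : E [⋀^Fin 1]→L[ℝ] ℂ ↦ ((ofRealForm η).wedge x : E [⋀^Fin 3]→L[ℝ] ℂ))
        (ContinuousAlternatingMap.wedge_add_right _))).map (AddMonoidHom.mk'
        (fun x : E [⋀^Fin 3]→L[ℝ] ℂ ↦ (wedgePow (ofRealForm η) j).wedge x)
        (ContinuousAlternatingMap.wedge_add_right _))).addSubgroupOf (integralForms Φ (2 * j + 3)) ≃+
      ((x : Fin (j + 2) ⊕ Fin (j + 2)) → ZMod ((j + 1).factorial * ∏ ν ∈ ({Sum.elim id id x} : Finset (Fin (j + 2)))ᶜ, d ν))) := by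
  classical
  have hn : 1 + (2 * j + 3) = 2 * (j + 2) := by ring
  have hkl : (2 * j + 3) + 1 = Fintype.card ι := lk_eq_card (ilvEnum e₀) hn
  letI : LinearOrder ι := linearOrderOfOrientation (ilvEnum e₀)
  obtain ⟨b, hb⟩ := exists_basis_integralForms_coe_eq_latMonomial_complWord Φ e₀ hkl
  refine nonempty_addEquiv_quotient_pi_zmod_of_basis b _
    (fun x ↦ Nat.mul_pos (Nat.factorial_pos _) (Finset.prod_pos fun ν _ ↦ h.pos hη ν))
    ((h.map_wedgePow_wedge_wedge_integralForms_one_eq_closure Φ hkl).trans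
      (congrArg AddSubgroup.closure (congrArg Set.range (funext fun x ↦ by rw [hb]))))

/-- **The cokernel of the divided power `θ^{[g−1]} : H¹(X, ℤ) → H^{2g−1}(X, ℤ)`**:
`(g−1)! · H^{2g−1}(X, ℤ)/θ^{∧(g−1)} ∧ H¹(X, ℤ) ≃+ ⊕_x ℤ/∏_{ν ≠ a(x)} d_ν` (`g = j + 2`) — trivial exactly for a principal polarisation
(g35-#1: then `θ^{[g−1]} ∧ (−) : H¹(X, ℤ) ⥲ H^{2g−1}(X, ℤ)`, Poincaré's formula `[C] = θ^{g−1}/(g−1)!`).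
[cite: Lange2023AbelianVarietiesComplex, §4.2 Poincaré's formula (PDF p. 204); §2.5.3 Cor. 2.5.17 (c) (PDF p. 135); §5.4.1 (5.22) (PDF p. 275)] [cite: VoisinHodgeI2002, §7.2.2 (PDF p. 142 L10)] -/
theorem IsSymplecticEnum.nonempty_addEquiv_map_nsmul_quotient_map_wedgePow_wedge_map_wedge_integralForms_one
    (h : IsSymplecticEnum Φ e₀ η d) (hη : IsRiemannForm Φ η) :
    Nonempty (↥((integralForms Φ (2 * j + 3)).map (nsmulAddMonoidHom (j + 1).factorial)) ⧸
        (((integralForms Φ 1).map (AddMonoidHom.mk'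
          (fun x : E [⋀^Fin 1]→L[ℝ] ℂ ↦ ((ofRealForm η).wedge x : E [⋀^Fin 3]→L[ℝ] ℂ))
          (ContinuousAlternatingMap.wedge_add_right _))).map (AddMonoidHom.mk'
          (fun x : E [⋀^Fin 3]→L[ℝ] ℂ ↦ (wedgePow (ofRealForm η) j).wedge x)
          (ContinuousAlternatingMap.wedge_add_right _))).addSubgroupOf
            ((integralForms Φ (2 * j + 3)).map (nsmulAddMonoidHom (j + 1).factorial)) ≃+
      ((x : Fin (j + 2) ⊕ Fin (j + 2)) → ZMod (∏ ν ∈ ({Sum.elim id id x} : Finset (Fin (j + 2)))ᶜ, d ν))) := by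
  classical
  have hn : 1 + (2 * j + 3) = 2 * (j + 2) := by ring
  have hkl : (2 * j + 3) + 1 = Fintype.card ι := lk_eq_card (ilvEnum e₀) hn
  letI : LinearOrder ι := linearOrderOfOrientation (ilvEnum e₀)
  obtain ⟨b, hb⟩ := exists_basis_integralForms_coe_eq_latMonomial_complWord Φ e₀ hkl
  exact nonempty_addEquiv_map_nsmul_quotient_pi_zmod_of_basis b (Nat.factorial_pos _) _
    (fun x ↦ Finset.prod_pos fun ν _ ↦ h.pos hη ν)
    ((h.map_wedgePow_wedge_wedge_integralForms_one_eq_closure Φ hkl).trans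
      (congrArg AddSubgroup.closure (congrArg Set.range (funext fun x ↦ by rw [hb]))))

/-! ## §3 Basis-free forms: any presentation of a polarised torus of type `(d₁, …, d_g)`; principal polarisations -/

/-- **`H^{2g−1}(X, ℤ)/θ^{∧(g−2)} ∧ H³(X, ℤ) ≃+ ⊕_x ℤ/((g−2)! ∏_{ν ∉ {a(x),t(a(x))}} d_ν)` for any polarised torus of type `(d₁, …, d_g)`**
(`IsPolarizationType`, `g = j + 2`; any presentation — symplectic re-presentation with the same lattice).
[cite: Lange2023AbelianVarietiesComplex, §1.5.1 (PDF p. 51); §5.4.1 Thm. 5.4.1 and (5.22) (PDF p. 275); §2.5.3 Thm. 2.5.16 (PDF p. 135)] [cite: VoisinHodgeI2002, §7.1.2 (PDF p. 134 L31)] -/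
theorem IsPolarizationType.nonempty_addEquiv_quotient_map_wedgePow_wedge_integralForms_three {Φ : (ι → ℝ) ≃L[ℝ] E}
    (hd : IsPolarizationType Φ η d) (hη : IsRiemannForm Φ η) :
    Nonempty (↥(integralForms Φ (2 * j + 3)) ⧸ ((integralForms Φ 3).map (AddMonoidHom.mk'
        (fun x : E [⋀^Fin 3]→L[ℝ] ℂ ↦ (wedgePow (ofRealForm η) j).wedge x)
        (ContinuousAlternatingMap.wedge_add_right _))).addSubgroupOf (integralForms Φ (2 * j + 3)) ≃+
      ((x : Fin (j + 2) ⊕ Fin (j + 2)) → ZMod (j.factorial * ∏ ν ∈ ({Sum.elim id id x,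
          if Sum.elim id id x = Fin.last (j + 1) then ((Fin.last j).castSucc : Fin (j + 2)) else Fin.last (j + 1)} :
            Finset (Fin (j + 2)))ᶜ, d ν))) := by
  obtain ⟨Φ', hΛ, hs⟩ := hd.exists_isSymplecticEnum Φ
  rw [integralForms_eq_of_range_latticeVec_eq hΛ.symm 3, integralForms_eq_of_range_latticeVec_eq hΛ.symm (2 * j + 3)]
  exact hs.nonempty_addEquiv_quotient_map_wedgePow_wedge_integralForms_three Φ' (hη.of_range_latticeVec_subset hΛ.le)

/-- **`(g−2)! · H^{2g−1}(X, ℤ)/θ^{∧(g−2)} ∧ H³(X, ℤ) ≃+ ⊕_x ℤ/∏_{ν ∉ {a(x),t(a(x))}} d_ν` for any polarised torus of type `(d₁, …, d_g)`**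
(the cokernel of the divided power `θ^{[g−2]}` on `H³(X, ℤ)`; `g = j + 2`).
[cite: Lange2023AbelianVarietiesComplex, §1.5.1 (PDF p. 51); §5.4.1 Thm. 5.4.1 and (5.22) (PDF p. 275); §2.5.3 Thm. 2.5.16, Cor. 2.5.17 (PDF p. 135)] [cite: VoisinHodgeI2002, §7.1.2 (PDF p. 134 L31)] -/
theorem IsPolarizationType.nonempty_addEquiv_map_nsmul_quotient_map_wedgePow_wedge_integralForms_three {Φ : (ι → ℝ) ≃L[ℝ] E}
    (hd : IsPolarizationType Φ η d) (hη : IsRiemannForm Φ η) :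
    Nonempty (↥((integralForms Φ (2 * j + 3)).map (nsmulAddMonoidHom j.factorial)) ⧸
        ((integralForms Φ 3).map (AddMonoidHom.mk'
          (fun x : E [⋀^Fin 3]→L[ℝ] ℂ ↦ (wedgePow (ofRealForm η) j).wedge x)
          (ContinuousAlternatingMap.wedge_add_right _))).addSubgroupOf
            ((integralForms Φ (2 * j + 3)).map (nsmulAddMonoidHom j.factorial)) ≃+
      ((x : Fin (j + 2) ⊕ Fin (j + 2)) → ZMod (∏ ν ∈ ({Sum.elim id id x,
          if Sum.elim id id x = Fin.last (j + 1) then ((Fin.last j).castSucc : Fin (j + 2)) else Fin.last (j + 1)} :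
            Finset (Fin (j + 2)))ᶜ, d ν))) := by
  obtain ⟨Φ', hΛ, hs⟩ := hd.exists_isSymplecticEnum Φ
  rw [integralForms_eq_of_range_latticeVec_eq hΛ.symm 3, integralForms_eq_of_range_latticeVec_eq hΛ.symm (2 * j + 3)]
  exact hs.nonempty_addEquiv_map_nsmul_quotient_map_wedgePow_wedge_integralForms_three Φ' (hη.of_range_latticeVec_subset hΛ.le)

/-- **`θ^{∧(g−2)} ∧ H³(X, ℤ) = (g−2)! · H^{2g−1}(X, ℤ)` for any polarised torus of type `(1, …, 1, d_g)`** (`g = j + 2`): the divided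
power `θ^{[g−2]}` maps `H³(X, ℤ)` onto `H^{2g−1}(X, ℤ)`.
[cite: Lange2023AbelianVarietiesComplex, §1.5.1 (PDF p. 51); §5.4.1 Thm. 5.4.1 and (5.22) (PDF p. 275); §2.5.3 Thm. 2.5.16 (PDF p. 135)] [cite: VoisinHodgeI2002, §7.1.2 (PDF p. 134 L31)] -/
theorem IsPolarizationType.map_wedgePow_wedge_integralForms_three_eq_map_nsmul_of_castSucc_eq_one {Φ : (ι → ℝ) ≃L[ℝ] E}
    (hd : IsPolarizationType Φ η d) (hη : IsRiemannForm Φ η) (h1 : ∀ i : Fin (j + 1), d i.castSucc = 1) :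
    (integralForms Φ 3).map (AddMonoidHom.mk'
        (fun x : E [⋀^Fin 3]→L[ℝ] ℂ ↦ (wedgePow (ofRealForm η) j).wedge x)
        (ContinuousAlternatingMap.wedge_add_right _)) =
      (integralForms Φ (2 * j + 3)).map (nsmulAddMonoidHom j.factorial) := by
  obtain ⟨Φ', hΛ, hs⟩ := hd.exists_isSymplecticEnum Φ
  rw [integralForms_eq_of_range_latticeVec_eq hΛ.symm 3, integralForms_eq_of_range_latticeVec_eq hΛ.symm (2 * j + 3)]
  exact hs.map_wedgePow_wedge_integralForms_three_eq_map_nsmul_of_castSucc_eq_one Φ' (hη.of_range_latticeVec_subset hΛ.le) h1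

/-- **`H^{2g−1}(X, ℤ)/θ^{∧(g−1)} ∧ H¹(X, ℤ) ≃+ ⊕_x ℤ/((g−1)! ∏_{ν ≠ a(x)} d_ν)` for any polarised torus of type `(d₁, …, d_g)`**
(`g = j + 2`; the image written as `θ^{∧(g−2)} ∧ (θ ∧ H¹(X, ℤ))`).
[cite: Lange2023AbelianVarietiesComplex, §1.5.1 (PDF p. 51); §2.5.3 Cor. 2.5.17 (c) (PDF p. 135); §5.4.1 (5.22) (PDF p. 275)] [cite: VoisinHodgeI2002, §7.2.2 (PDF p. 142 L10)] -/
theorem IsPolarizationType.nonempty_addEquiv_quotient_map_wedgePow_wedge_map_wedge_integralForms_one {Φ : (ι → ℝ) ≃L[ℝ] E}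
    (hd : IsPolarizationType Φ η d) (hη : IsRiemannForm Φ η) :
    Nonempty (↥(integralForms Φ (2 * j + 3)) ⧸ (((integralForms Φ 1).map (AddMonoidHom.mk'
        (fun x : E [⋀^Fin 1]→L[ℝ] ℂ ↦ ((ofRealForm η).wedge x : E [⋀^Fin 3]→L[ℝ] ℂ))
        (ContinuousAlternatingMap.wedge_add_right _))).map (AddMonoidHom.mk'
        (fun x : E [⋀^Fin 3]→L[ℝ] ℂ ↦ (wedgePow (ofRealForm η) j).wedge x)
        (ContinuousAlternatingMap.wedge_add_right _))).addSubgroupOf (integralForms Φ (2 * j + 3)) ≃+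
      ((x : Fin (j + 2) ⊕ Fin (j + 2)) → ZMod ((j + 1).factorial * ∏ ν ∈ ({Sum.elim id id x} : Finset (Fin (j + 2)))ᶜ, d ν))) := by
  obtain ⟨Φ', hΛ, hs⟩ := hd.exists_isSymplecticEnum Φ
  rw [integralForms_eq_of_range_latticeVec_eq hΛ.symm 1, integralForms_eq_of_range_latticeVec_eq hΛ.symm (2 * j + 3)]
  exact hs.nonempty_addEquiv_quotient_map_wedgePow_wedge_map_wedge_integralForms_one Φ' (hη.of_range_latticeVec_subset hΛ.le)

/-- **Principal polarisation: `θ^{∧(g−2)} ∧ H³(X, ℤ) = (g−2)! · H^{2g−1}(X, ℤ)`** (`|ι| = 2g`, `g = j + 2`; any presentation) — the divided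
power `θ^{[g−2]} = θ^{∧(g−2)}/(g−2)!` maps `H³(X, ℤ)` ONTO `H^{2g−1}(X, ℤ)` on a principally polarised complex torus (over `ℚ` this is
hard Lefschetz; over `ℤ` it is special to degree `2g − 1`: on `H² → H^{2g−2}` and `H³ → H^{2g−3}` the divided powers have the non-trivial
cokernels `ℤ/(g−1)` and `(ℤ/(g−2))^{2g}`, g35-#4 and g38-#1).
[cite: Lange2023AbelianVarietiesComplex, §2.1.1; §5.4.1 Thm. 5.4.1 and (5.22) (PDF p. 275); §2.5.3 Thm. 2.5.16, Cor. 2.5.17 (PDF p. 135); §4.2 Poincaré's formula (PDF p. 204)] [cite: VoisinHodgeI2002, §6.2.3 Thm. 6.25 (PDF p. 125); §7.1.2 (PDF p. 134 L31)] -/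
theorem IsPrincipalPolarization.map_wedgePow_wedge_integralForms_three_eq_map_nsmul {Φ : (ι → ℝ) ≃L[ℝ] E}
    (hp : IsPrincipalPolarization Φ η) (hj : Fintype.card ι = 2 * (j + 2)) :
    (integralForms Φ 3).map (AddMonoidHom.mk'
        (fun x : E [⋀^Fin 3]→L[ℝ] ℂ ↦ (wedgePow (ofRealForm η) j).wedge x)
        (ContinuousAlternatingMap.wedge_add_right _)) =
      (integralForms Φ (2 * j + 3)).map (nsmulAddMonoidHom j.factorial) := by
  obtain ⟨g, d', hd', h1⟩ := hp.exists_type_eq_one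
  have hg : j + 2 = g := by have := hd'.card_eq; omega
  obtain ⟨Φ', hΛ, hs⟩ := (hd'.comp_cast hg).exists_isSymplecticEnum Φ
  rw [integralForms_eq_of_range_latticeVec_eq hΛ.symm 3, integralForms_eq_of_range_latticeVec_eq hΛ.symm (2 * j + 3)]
  exact hs.map_wedgePow_wedge_integralForms_three_eq_map_nsmul_of_type_one Φ' (hp.isRiemannForm.of_range_latticeVec_subset hΛ.le)
    fun i ↦ h1 _

/-- **Elementwise, principal polarisation: every `γ ∈ H^{2g−1}(X, ℤ)` has `(g−2)! · γ = θ^{∧(g−2)} ∧ x` for an integral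
`x ∈ H³(X, ℤ)`** (`|ι| = 2g`, `g = j + 2`). [cite: Lange2023AbelianVarietiesComplex, §2.1.1; §5.4.1 (5.22) (PDF p. 275); §4.2 (PDF p. 204)] -/
theorem IsPrincipalPolarization.exists_wedgePow_wedge_three_eq_factorial_nsmul {Φ : (ι → ℝ) ≃L[ℝ] E}
    (hp : IsPrincipalPolarization Φ η) (hj : Fintype.card ι = 2 * (j + 2)) {γ : E [⋀^Fin (2 * j + 3)]→L[ℝ] ℂ}
    (hγ : γ ∈ integralForms Φ (2 * j + 3)) :
    ∃ x ∈ integralForms Φ 3, (wedgePow (ofRealForm η) j).wedge x = j.factorial • γ := by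
  have hmem : j.factorial • γ ∈ (integralForms Φ 3).map (AddMonoidHom.mk'
      (fun x : E [⋀^Fin 3]→L[ℝ] ℂ ↦ (wedgePow (ofRealForm η) j).wedge x)
      (ContinuousAlternatingMap.wedge_add_right _)) := by
    rw [hp.map_wedgePow_wedge_integralForms_three_eq_map_nsmul hj]
    exact ⟨γ, hγ, rfl⟩
  obtain ⟨x, hx, hxeq⟩ := hmem
  exact ⟨x, hx, hxeq⟩

end CoLefschetzCokernel

end Literature.Geometry.Kaehler.ComplexTorus
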